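import Literature.NumberTheory.EllipticCurves.GrossPointsThetaElement
import Literature.NumberTheory.EllipticCurves.QuadOrderPicardFinite
import Literature.NumberTheory.EllipticCurves.QuadOrderPicardKernelGenerators
import Literature.NumberTheory.EllipticCurves.QuadOrderPicardCoprime
import HarnessLib

/-!
# The kernels of `Pic(𝒪_{p^{n+2}}) → Pic(𝒪_{p^{n+1}})` (order `p`) and `→ Pic(𝒪_{p^{n}})` (cyclic of order `p²`, `p` odd):
# the layer structure behind `Δ ↪ Pic(𝒪_{p^{n+1}})` for the torsion `Δ` of `G̃_∞ = lim Pic(𝒪_{p^n})`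

Route-independent `Theorems` file (cell `b2b-bsdres`, seat `b2b-bsdres-x10b` = class owner X6/X7, gen 43); part 2a of the
series «defmu / supersingular theta elements» serving crux 2 `KobayashiLowerHalfSemistable` (stmt-BirchSwinnertonDyer-19000).
HONEST FRAMING: prove what is provable now; shrink each hard class to its core with data; no claim beyond stated classes.
Nothing about any curve is asserted and NO summit statement is proved here; BSD is not proved by any of this.

Darmon–Iovita (J. Inst. Math. Jussieu 7 (2008), §2.2) and Bertolini–Darmon (Ann. of Math. 162 (2005), §1.2) write
`G̃_∞ = Δ × G_∞` with `Δ` the (finite) torsion subgroup and `G_∞ ≃ ℤ_p`, and set `G_n := G̃_{n+1}/Δ` — implicitly: `Δ` maps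
INJECTIVELY to every layer `G̃_{n+1} = Pic(𝒪_{p^{n+1}})`, `n ≥ 0`. The tree's `torsionImage K p n ⊆ Pic(𝒪_{p^n})` (file
`GrossPointsThetaElement.lean`) is the image of `Δ` (classes with lifts of one bounded exponent to every higher layer) and
`AcLayerGroup K p n = Pic(𝒪_{p^n}) ⧸ torsionImage` are the anticyclotomic layer groups carrying `thetaAc`, `lAc`,
`HasMuZeroAc`, `HasMuZeroLAc`. NO structural fact about `torsionImage` was in the tree. This file (§§1–4) and its
sequel `…DefmuTorsionImageTower.lean` (§§5–8) prove, for `K` imaginary quadratic and `p` an ODD prime (from Cox's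
description of the kernels `Pic(𝒪_{cp}) → Pic(𝒪_c)`, tree files `QuadOrderPicardTower` / `QuadOrderPicardCoprime`):

* §1 `picRes_mem_torsionImage` — the restrictions map `torsionImage (m)` INTO `torsionImage (n)` (`n ≤ m`).
* §2 `pow_eq_one_of_picRes_eq_one`, `natCard_ker_picRes` — the kernel of `Pic(𝒪_{p^{m+2}}) → Pic(𝒪_{p^{m+1}})` has order
  `p`, hence is killed by `p`.
* §3 `exists_picRes_eq_one_and_pow_ne_one` — the kernel of the TWO-step map `Pic(𝒪_{p^{k+3}}) → Pic(𝒪_{p^{k+1}})` contains an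
  element of order `p²`: the class of Cox's ideal `𝔞_v = v𝒪_{cp²} + p²𝒪_c`, `v = 1 + cω`, `c = p^{k+1}` (`kerUnitOf` of
  `QuadOrderPicardCoprime` with `ℓ = p²`), whose `p`-th power is `𝔞_{v^p}` with `v^p = X + cpY₁ω`, `p ∤ Y₁` (`p` odd), and
  `𝔞_{v^p}` is not principal (`1 ∉ 𝔞_{v^p}` by comparing `ω`-coordinates). So that kernel (order `p²`) is CYCLIC.
* §4–5 `pow_prime_ne_one_of_picRes`, `pow_pow_ne_one_of_picRes` — order growth along the tower: an element of
  `ker(Pic(𝒪_{p^{k+2+j}}) → Pic(𝒪_{p^{k+1}}))` NOT in `ker(→ Pic(𝒪_{p^{k+2}}))` has `g^{p^j} ≠ 1`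
  (i.e. `ker(G̃_∞ → G̃_{k+1}) ≃ ℤ_p` is torsion-free; `1 + p𝒪_K ⊗ ℤ_p` has no torsion for `p` odd).
* §6 `eq_one_of_mem_torsionImage_of_picRes_eq_one` — **`Δ ∩ ker = 1`**: `torsionImage (k+2) ∩ ker(→ Pic(𝒪_{p^{k+1}})) = {1}`.
* §7 `exists_mem_torsionImage_picRes_eq` — **`Δ ↠ Δ`**: `torsionImage (n+1) → torsionImage (n)` is ONTO (compactness: a
  decreasing sequence of non-empty finite sets of lifts stabilises; every `n ≥ 0`, any prime).
* §8 `bijOn_picRes_torsionImage`, `sum_torsionImage_comp_picRes` — the restriction is a BIJECTION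
  `torsionImage (k+2) ≃ torsionImage (k+1)` and sums over `Δ`-cosets transport along it (the input of DI's relation (8)
  for the anticyclotomic elements `L_n`, part 3 of the series).

## References

* [DarmonIovita2008] H. Darmon, A. Iovita, J. Inst. Math. Jussieu 7 (2008), §2.2 ("`G̃_∞ = Δ × G_∞` … `G_n := G̃_{n+1}/Δ`").
* [BertoliniDarmon2005] M. Bertolini, H. Darmon, Ann. of Math. 162 (2005), §1.2 (18)–(21).
* [Cox2013] D. A. Cox, *Primes of the form x² + ny²*, 2nd ed., §7.D Thm. 7.24, (7.25)–(7.27) (the kernels, via the tree).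
-/

noncomputable section

open scoped BigOperators

-- D-0017: single-problem summit, the namespace repeats the problem name by design.
set_option linter.dupNamespace false

namespace Summit.BirchSwinnertonDyer.BirchSwinnertonDyer.Theorems.DefmuSupersingularTheta

open Literature.NumberTheory.EllipticCurves Literature.NumberTheory.EllipticCurves.QuadOrderTower
  Literature.NumberTheory.QuadraticFields.Quadratic NumberField Module

universe u

variable {K : Type u} [Field K] [NumberField K] (p : ℕ) [hp : Fact p.Prime]

/-! ### §1 The restrictions map `torsionImage` into `torsionImage` -/

omit hp in
/-- A class in `torsionImage (n)` is torsion (of the exponent witnessing membership). [cite: BertoliniDarmon2005, §1.2 (21)] -/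
theorem pow_eq_one_of_mem_torsionImage {n : ℕ} {g : ClassGroup (quadOrder K (p ^ n))} [NeZero (p ^ n)]
    {e : ℕ} (hlift : ∀ m (h : n ≤ m), ∃ g' : ClassGroup (quadOrder K (p ^ m)),
      g' ^ e = 1 ∧ picRes K (pow_dvd_pow p h) g' = g) : g ^ e = 1 := by
  obtain ⟨g', hg'e, hg'⟩ := hlift n le_rfl
  rw [picRes_self] at hg'
  rw [← hg', hg'e]

/-- **`Δ → Δ`**: the restriction `Pic(𝒪_{p^m}) → Pic(𝒪_{p^n})` (`n ≤ m`) maps `torsionImage (m)` into `torsionImage (n)`.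
[cite: BertoliniDarmon2005, §1.2 (21)] [cite: DarmonIovita2008, §2.2] -/
theorem picRes_mem_torsionImage {n m : ℕ} (hnm : n ≤ m) {g : ClassGroup (quadOrder K (p ^ m))}
    (hg : g ∈ torsionImage K p m) : picRes K (pow_dvd_pow p hnm) g ∈ torsionImage K p n := by
  obtain ⟨e, he, hlift⟩ := hg
  have hge : g ^ e = 1 := pow_eq_one_of_mem_torsionImage p hlift
  refine ⟨e, he, fun M hM => ?_⟩
  by_cases hMm : m ≤ M
  · obtain ⟨g', hg'e, hg'⟩ := hlift M hMm
    exact ⟨g', hg'e, by rw [← picRes_picRes (pow_dvd_pow p hnm) (pow_dvd_pow p hMm), hg']⟩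
  · push Not at hMm
    refine ⟨picRes K (pow_dvd_pow p hMm.le) g, by rw [← map_pow, hge, map_one], ?_⟩
    rw [picRes_picRes]

/-! ### §2 The one-step kernels above level `1` have order `p` -/

/-- **`#ker(Pic(𝒪_{p^{m+2}}) → Pic(𝒪_{p^{m+1}})) = p`** (Cox (7.27) for `p ∣ c = p^{m+1}`: the kernel is
`{[𝔞_k] : 0 ≤ k < p}`, tree `QuadOrderTower.card_filter_picRes_eq`). [cite: Cox2013, §7.D Thm. 7.24 (7.25)–(7.27)] -/
theorem natCard_ker_picRes (hK : IsImaginaryQuadratic K) (m : ℕ) :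
    Nat.card (picRes K (pow_dvd_pow p (m + 1).le_succ)).ker = p := by
  classical
  obtain ⟨b, hb⟩ := exists_basis_zero_eq_one (K := K) hK.1
  haveI := @Fintype.ofFinite (ClassGroup (quadOrder K (p ^ (m + 2)))) (finite_classGroup (K := K) _)
  have hd : p ^ (m + 2) = p ^ (m + 1) * p := pow_succ p (m + 1)
  have hpc : p ∣ p ^ (m + 1) := dvd_pow_self p m.succ_ne_zero
  have hcard := card_filter_picRes_eq hb hK hpc hd (1 : ClassGroup (quadOrder K (p ^ (m + 2))))
  rw [map_one] at hcard
  have h1 : Nat.card (picRes K (pow_dvd_pow p (m + 1).le_succ)).ker =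
      Nat.card {σ // picRes K (pow_dvd_pow p (m + 1).le_succ) σ = 1} := rfl
  rw [h1, Nat.card_eq_fintype_card, Fintype.card_subtype]
  exact hcard

/-- **The one-step kernel is killed by `p`**: `picRes κ = 1 ⇒ κ^p = 1` at levels `p^{m+2} → p^{m+1}`.
[cite: Cox2013, §7.D Thm. 7.24 (7.25)–(7.27)] -/
theorem pow_eq_one_of_picRes_eq_one (hK : IsImaginaryQuadratic K) (m : ℕ)
    {κ : ClassGroup (quadOrder K (p ^ (m + 2)))}
    (hκ : picRes K (pow_dvd_pow p (m + 1).le_succ) κ = 1) : κ ^ p = 1 := by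
  have hmem : κ ∈ (picRes K (pow_dvd_pow p (m + 1).le_succ)).ker := hκ
  have h := pow_card_eq_one' (G := (picRes K (pow_dvd_pow p (m + 1).le_succ)).ker) (x := ⟨κ, hmem⟩)
  rw [natCard_ker_picRes p hK m] at h
  exact congrArg Subtype.val h

/-! ### §3 An element of order `p²` in the two-step kernel (`p` odd) -/

omit [NumberField K] hp in
/-- `ω² = m + tω` in `K` (`m = mConst b`, `t = tConst b`). [cite: Cox2013, §7.A Lemma 7.2] -/
private theorem omega_sq (b : Basis (Fin 2) ℤ (𝓞 K)) (hb : b 0 = 1) :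
    omega b * omega b = (mConst b : K) + (tConst b : K) * omega b := by
  have h' := congrArg (algebraMap (𝓞 K) K) (basis_one_mul_self_eq b hb)
  simpa [omega, mConst, tConst] using h'

omit [NumberField K] hp in
/-- Coordinates of `(1 + cω)^j = X_j + c y_j ω`: `c² ∣ X_j − 1` and `y_j ≡ j + ct·T_j (mod cp)` with `2T_j = j(j−1)`
(`p ∣ c`). [folklore] -/
private theorem pow_one_add_coords (b : Basis (Fin 2) ℤ (𝓞 K)) (hb : b 0 = 1) (c : ℕ) (hpc : (p : ℤ) ∣ c)
    (j : ℕ) : ∃ X y T : ℤ, (1 + (c : K) * omega b) ^ j = (X : K) + ((c * y : ℤ) : K) * omega b ∧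
      ((c : ℤ) * c ∣ X - 1) ∧ ((c : ℤ) * p ∣ y - (j + c * tConst b * T)) ∧ 2 * T = (j : ℤ) * ((j : ℤ) - 1) := by
  induction j with
  | zero => exact ⟨1, 0, 0, by simp, by simp, by simp, by simp⟩
  | succ j ih =>
    obtain ⟨X, y, T, hpow, hX, hy, hT⟩ := ih
    have hω := omega_sq b hb
    refine ⟨X + c * c * y * mConst b, X + y + c * y * tConst b, T + j, ?_, ?_, ?_, ?_⟩
    · rw [pow_succ, hpow]
      push_cast
      linear_combination ((c : K) * (c : K) * (y : K)) * hω
    · have e : X + c * c * y * mConst b - 1 = (X - 1) + c * c * (y * mConst b) := by ring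
      rw [e]
      exact dvd_add hX (dvd_mul_right _ _)
    · have hcp_cc : (c : ℤ) * p ∣ (c : ℤ) * c := mul_dvd_mul_left _ hpc
      have e : X + y + c * y * tConst b - ((((j + 1 : ℕ) : ℤ)) + c * tConst b * (T + j)) =
          (X - 1) + (y - (j + c * tConst b * T)) * (1 + c * tConst b) +
            c * c * (tConst b * tConst b * T) := by
        push_cast; ring
      rw [e]
      exact dvd_add (dvd_add (hcp_cc.trans hX) (hy.mul_right _)) (hcp_cc.trans (dvd_mul_right _ _))
    · push_cast
      linear_combination hT

omit [NumberField K] in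
/-- `(1 + cω)^p = X + cpY₁ω` with `p ∤ Y₁` (`p ∣ c`, `p` odd): `y_p ≡ p + ct·p(p−1)/2 ≡ p (mod cp)` and `p² ∣ cp`.
[folklore] -/
private theorem pow_prime_one_add_coords (b : Basis (Fin 2) ℤ (𝓞 K)) (hb : b 0 = 1) (c : ℕ)
    (hpc : (p : ℤ) ∣ c) (hp2 : p ≠ 2) :
    ∃ X Y₁ : ℤ, (1 + (c : K) * omega b) ^ p = (X : K) + ((c * p * Y₁ : ℤ) : K) * omega b ∧ ¬ (p : ℤ) ∣ Y₁ := by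
  obtain ⟨X, y, T, hpow, -, hy, hT⟩ := pow_one_add_coords p b hb c hpc p
  have hpT : (p : ℤ) ∣ T := by
    have h2 : (p : ℤ) ∣ 2 * T := ⟨(p : ℤ) - 1, by rw [hT]⟩
    have hprime : Prime (p : ℤ) := Nat.prime_iff_prime_int.mp hp.out
    rcases hprime.dvd_or_dvd h2 with h | h
    · exfalso
      have h' : p ∣ 2 := by exact_mod_cast h
      have := (Nat.prime_dvd_prime_iff_eq hp.out Nat.prime_two).mp h'
      exact hp2 this
    · exact h
  obtain ⟨T', rfl⟩ := hpT
  obtain ⟨w, hw⟩ := hy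
  obtain ⟨c', hc'⟩ := hpc
  have hy' : y = p * (1 + c * (tConst b * T' + w)) := by linear_combination hw
  refine ⟨X, 1 + c * (tConst b * T' + w), ?_, ?_⟩
  · rw [hpow, hy']
    congr 2
    push_cast
    ring
  · rintro ⟨z, hz⟩
    have h1 : (p : ℤ) ∣ 1 := ⟨z - c' * (tConst b * T' + w), by linear_combination hz - (tConst b * T' + w) * hc'⟩
    exact hp.out.not_dvd_one (by exact_mod_cast h1)

/-- `𝔞_v^j = 𝔞_{v^j}` for Cox's kernel ideals `𝔞_v = v𝒪_d + ℓ𝒪_c` with `N(v) = v v'` prime to `ℓ` (iterated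
multiplicativity `kerFrac_sub_one_mul_kerFrac_sub_one_eq`). [cite: Cox2013, §7.D Thm. 7.24 (7.25)–(7.27)] -/
private theorem kerFrac_sub_one_pow {c d : ℕ} [NeZero d] {ℓ : ℕ} (hd : d = c * ℓ) {v v' : K}
    (hv : v ∈ quadOrder K c) (hv' : v' ∈ quadOrder K c) {n : ℤ} (hvv' : v * v' = n) (hn : IsCoprime n ℓ)
    (j : ℕ) : kerFrac (Dvd.intro ℓ hd.symm) ℓ (v - 1) ^ j = kerFrac (Dvd.intro ℓ hd.symm) ℓ (v ^ j - 1) := by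
  induction j with
  | zero => rw [pow_zero, pow_zero, kerFrac_one_sub_one_eq_one hd]
  | succ j ih =>
    rw [pow_succ, ih, pow_succ]
    refine kerFrac_sub_one_mul_kerFrac_sub_one_eq hd (Subalgebra.pow_mem _ hv j) (Subalgebra.pow_mem _ hv' j) hv
      (n := n ^ j) ?_ (hn.pow_left)
    rw [← mul_pow, hvv', Int.cast_pow]

/-- **An element of order `p²` in `ker(Pic(𝒪_{p^{k+3}}) → Pic(𝒪_{p^{k+1}}))`** (`K` imaginary quadratic, `p` odd): the
class `g₀` of Cox's invertible ideal `𝔞_v = v𝒪_{cp²} + p²𝒪_c`, `v = 1 + cω`, `c = p^{k+1}` (`N(v) = 1 + ct − c²m ≡ 1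
(mod p)`), restricts to `1` in `Pic(𝒪_c)` and has `g₀^p = [𝔞_{v^p}] ≠ 1`: `v^p = X + cpY₁ω` with `p ∤ Y₁`, and
`1 = (U + Vω) v^p + p²(R + Sω)` with `cp² ∣ V`, `c ∣ S` is impossible (`ω`-coordinate ⇒ `p ∣ U`, constant ⇒ `p ∣ 1`).
Consequence: that kernel (order `p²`) is cyclic; equivalently `ker(G̃_∞ → G̃_{k+1})` is torsion-free.
[cite: Cox2013, §7.D Thm. 7.24 (7.25)–(7.27)] [cite: DarmonIovita2008, §2.2] -/
theorem exists_picRes_eq_one_and_pow_ne_one (hK : IsImaginaryQuadratic K) (hp2 : p ≠ 2) (k : ℕ) :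
    ∃ g₀ : ClassGroup (quadOrder K (p ^ (k + 3))),
      picRes K (pow_dvd_pow p (by omega : k + 1 ≤ k + 3)) g₀ = 1 ∧ g₀ ^ p ≠ 1 := by
  classical
  obtain ⟨b, hb⟩ := exists_basis_zero_eq_one (K := K) hK.1
  set c : ℕ := p ^ (k + 1) with hc
  have hd : p ^ (k + 3) = c * p ^ 2 := by rw [hc, ← pow_add]
  have hpcN : p ∣ c := by rw [hc]; exact dvd_pow_self p k.succ_ne_zero
  have hpc : (p : ℤ) ∣ (c : ℤ) := by exact_mod_cast hpcN
  have hc2 : 2 ≤ c := le_trans hp.out.two_le (Nat.le_of_dvd (NeZero.pos c) hpcN)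
  have hω := omega_sq b hb
  -- `v = 1 + cω`, `v' = (1 + ct) − cω`, `v v' = n = 1 + ct − c²m`
  have hv : (1 : K) + (c : K) * omega b ∈ quadOrder K c := by
    have := coords_mem_quadOrder b hb (K := K) (c := c) (X := 1) (Y := c) (dvd_refl _)
    simpa using this
  have hv' : (((1 + c * tConst b : ℤ)) : K) + ((-(c : ℤ) : ℤ) : K) * omega b ∈ quadOrder K c :=
    coords_mem_quadOrder b hb (dvd_neg.mpr (dvd_refl _))
  have hvv' : ((1 : K) + (c : K) * omega b) *
      ((((1 + c * tConst b : ℤ)) : K) + ((-(c : ℤ) : ℤ) : K) * omega b) =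
        ((1 + c * tConst b - c * c * mConst b : ℤ) : K) := by
    push_cast
    linear_combination (-((c : K) * (c : K))) * hω
  have hn : IsCoprime (1 + c * tConst b - c * c * mConst b : ℤ) ((p ^ 2 : ℕ) : ℤ) := by
    obtain ⟨c', hc'⟩ := hpc
    have h1 : IsCoprime (1 + c * tConst b - c * c * mConst b : ℤ) (p : ℤ) := by
      refine ⟨1, -(c' * tConst b - c' * c * mConst b), ?_⟩
      linear_combination (tConst b - c * mConst b) * hc'
    push_cast
    exact h1.pow_right
  let 𝔟 := kerUnitOf hd hv hv' hvv' hn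
  refine ⟨ClassGroup.mk K 𝔟, ?_, fun hpow1 => ?_⟩
  · exact picRes_mk_kerUnitOf hd hv hv' hvv' hn
  -- `g₀^p = [𝔞_{v^p}]`
  obtain ⟨X, Y₁, hvp, hY₁⟩ := pow_prime_one_add_coords p b hb c hpc hp2
  have hvp_mem : ((1 : K) + (c : K) * omega b) ^ p ∈ quadOrder K c := Subalgebra.pow_mem _ hv p
  have hv'p_mem : ((((1 + c * tConst b : ℤ)) : K) + ((-(c : ℤ) : ℤ) : K) * omega b) ^ p ∈ quadOrder K c :=
    Subalgebra.pow_mem _ hv' p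
  have hvv'p : ((1 : K) + (c : K) * omega b) ^ p *
      ((((1 + c * tConst b : ℤ)) : K) + ((-(c : ℤ) : ℤ) : K) * omega b) ^ p =
        (((1 + c * tConst b - c * c * mConst b) ^ p : ℤ) : K) := by
    rw [← mul_pow, hvv', Int.cast_pow]
  have hnp : IsCoprime ((1 + c * tConst b - c * c * mConst b) ^ p : ℤ) ((p ^ 2 : ℕ) : ℤ) := hn.pow_left
  have hunit_eq : 𝔟 ^ p = kerUnitOf hd hvp_mem hv'p_mem hvv'p hnp := by
    refine Units.ext ?_
    rw [Units.val_pow_eq_pow_val, coe_kerUnitOf, coe_kerUnitOf]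
    exact kerFrac_sub_one_pow hd hv hv' hvv' hn p
  -- the trivial class `[𝔞_1] = 1`
  have h1u : ClassGroup.mk K (kerUnitOf hd (v := (1 : K)) (v' := 1) (n := 1) (Subalgebra.one_mem _)
      (Subalgebra.one_mem _) (by simp) (isCoprime_one_left)) = 1 := by
    rw [ClassGroup.mk_eq_one_iff, FractionalIdeal.isPrincipal_iff]
    exact ⟨1, by rw [FractionalIdeal.spanSingleton_one, coe_kerUnitOf, kerFrac_one_sub_one_eq_one hd]⟩
  have hmk : ClassGroup.mk K (kerUnitOf hd hvp_mem hv'p_mem hvv'p hnp) =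
      ClassGroup.mk K (kerUnitOf hd (v := (1 : K)) (v' := 1) (n := 1) (Subalgebra.one_mem _)
        (Subalgebra.one_mem _) (by simp) (isCoprime_one_left)) := by
    rw [← hunit_eq, map_pow, hpow1, h1u]
  have hunits := coe_units_quadOrder_eq_one_or_eq_neg_one hK hc2
  have hmem := mem_of_mk_kerUnitOf_eq hunits hd hvp_mem hv'p_mem hvv'p hnp (Subalgebra.one_mem _)
    (Subalgebra.one_mem _) (by simp) isCoprime_one_left hmk
  -- `1 = u v^p + p² r`, `u ∈ 𝒪_{cp²}`, `r ∈ 𝒪_c`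
  rw [mem_kerFrac_sub_one_iff] at hmem
  obtain ⟨u, hu, r, hr, h1⟩ := hmem
  rw [hvp] at h1
  obtain ⟨U, V, hV, rfl⟩ := (mem_quadOrder_iff_coords b hb).mp hu
  obtain ⟨R, S, hS, rfl⟩ := (mem_quadOrder_iff_coords b hb).mp hr
  have hfinal : (((1 : ℤ)) : K) + (((0 : ℤ)) : K) * omega b =
      ((U * X + V * (c * p * Y₁) * mConst b + (p : ℤ) ^ 2 * R : ℤ) : K) +
        ((U * (c * p * Y₁) + V * X + V * (c * p * Y₁) * tConst b + (p : ℤ) ^ 2 * S : ℤ) : K) * omega b := by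
    push_cast at h1 ⊢
    linear_combination h1 + ((V : K) * ((c : K) * (p : K) * (Y₁ : K))) * hω
  obtain ⟨h0, hω1⟩ := coords_unique b hb hfinal
  -- `cp² ∣ V`, `c ∣ S`
  rw [hd] at hV
  obtain ⟨V', rfl⟩ := hV
  obtain ⟨S', rfl⟩ := hS
  have hc0 : (c : ℤ) ≠ 0 := by exact_mod_cast (NeZero.ne c)
  -- `ω`-coordinate divided by `c`: `U Y₁ = −p (...)`, so `p ∣ U`
  have hω2 : U * Y₁ = -(p : ℤ) * (V' * X + (c : ℤ) * (p : ℤ) * V' * Y₁ * tConst b + S') := by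
    have h3 : (c : ℤ) * (p * (U * Y₁ + (p : ℤ) * (V' * X + (c : ℤ) * (p : ℤ) * V' * Y₁ * tConst b + S'))) = 0 := by
      push_cast at hω1
      linear_combination -hω1
    have h4 : U * Y₁ + (p : ℤ) * (V' * X + (c : ℤ) * (p : ℤ) * V' * Y₁ * tConst b + S') = 0 := by
      have hp0 : (p : ℤ) ≠ 0 := by exact_mod_cast hp.out.ne_zero
      rcases mul_eq_zero.mp h3 with h | h
      · exact absurd h hc0
      · rcases mul_eq_zero.mp h with h' | h'
        · exact absurd h' hp0
        · exact h'
    linear_combination h4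
  have hprime : Prime (p : ℤ) := Nat.prime_iff_prime_int.mp hp.out
  have hpU : (p : ℤ) ∣ U := by
    have : (p : ℤ) ∣ U * Y₁ := ⟨-(V' * X + (c : ℤ) * (p : ℤ) * V' * Y₁ * tConst b + S'), by rw [hω2]; ring⟩
    rcases hprime.dvd_or_dvd this with h | h
    · exact h
    · exact absurd h hY₁
  obtain ⟨U', rfl⟩ := hpU
  -- constant coordinate: `1 = p(…)`
  have h1' : (p : ℤ) ∣ 1 :=
    ⟨U' * X + (c : ℤ) * (p : ℤ) ^ 2 * V' * (c * Y₁) * mConst b + (p : ℤ) * R, by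
      push_cast at h0 ⊢; linear_combination h0⟩
  exact hp.out.not_dvd_one (by exact_mod_cast h1')

/-! ### §4 In the two-step kernel, elements off the one-step kernel have `g^p ≠ 1` -/

/-- **`ker(Pic(𝒪_{p^{k+3}}) → Pic(𝒪_{p^{k+1}}))` is cyclic of order `p²`**, in the form used below: every element of it
NOT in `ker(→ Pic(𝒪_{p^{k+2}}))` has `g^p ≠ 1` (`K` imaginary quadratic, `p` odd). Proof: the one-step kernel below has
prime order `p`, so is generated by the image `κ` of `g`; writing the image of the order-`p²` element `g₀` of §3 as `κ^i`,
`g₀ (g^i)⁻¹` lies in the one-step kernel above (killed by `p`), whence `g₀^p = (g^p)^i`. [cite: Cox2013, §7.D Thm. 7.24 (7.25)–(7.27)]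
[cite: DarmonIovita2008, §2.2] -/
theorem pow_prime_ne_one_of_picRes (hK : IsImaginaryQuadratic K) (hp2 : p ≠ 2) (k : ℕ)
    {g : ClassGroup (quadOrder K (p ^ (k + 3)))}
    (h1 : picRes K (pow_dvd_pow p (by omega : k + 1 ≤ k + 3)) g = 1)
    (h2 : picRes K (pow_dvd_pow p (by omega : k + 2 ≤ k + 3)) g ≠ 1) : g ^ p ≠ 1 := by
  obtain ⟨g₀, hg₀1, hg₀p⟩ := exists_picRes_eq_one_and_pow_ne_one p hK hp2 k
  set π32 := picRes K (pow_dvd_pow p (by omega : k + 2 ≤ k + 3)) with hπ32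
  set π21 := picRes K (pow_dvd_pow p (k + 1).le_succ) with hπ21
  have hκ : π21 (π32 g) = 1 := by rw [hπ21, hπ32, picRes_picRes]; exact h1
  have hκ₀ : π21 (π32 g₀) = 1 := by rw [hπ21, hπ32, picRes_picRes]; exact hg₀1
  -- the one-step kernel `ker π21` has prime order `p` and is generated by `π32 g ≠ 1`
  have hcardH : Nat.card π21.ker = p := natCard_ker_picRes p hK k
  have hne : (⟨π32 g, hκ⟩ : π21.ker) ≠ 1 := fun h => h2 (congrArg Subtype.val h)
  have htop := zpowers_eq_top_of_prime_card hcardH hne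
  have hmem : (⟨π32 g₀, hκ₀⟩ : π21.ker) ∈ Subgroup.zpowers (⟨π32 g, hκ⟩ : π21.ker) := by
    rw [htop]; exact Subgroup.mem_top _
  obtain ⟨i, hi⟩ := Subgroup.mem_zpowers_iff.mp hmem
  have hi' : π32 g ^ i = π32 g₀ := by
    have := congrArg Subtype.val hi
    simpa using this
  -- `q = g₀ (g^i)⁻¹ ∈ ker π32` is killed by `p`
  have hq : π32 (g₀ * (g ^ i)⁻¹) = 1 := by rw [map_mul, map_inv, map_zpow, hi', mul_inv_cancel]
  have hqp : (g₀ * (g ^ i)⁻¹) ^ p = 1 := pow_eq_one_of_picRes_eq_one p hK (k + 1) hq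
  intro hgp
  apply hg₀p
  calc g₀ ^ p = (g₀ * (g ^ i)⁻¹) ^ p * (g ^ i) ^ p := by rw [← mul_pow, inv_mul_cancel_right]
    _ = 1 := by rw [hqp, one_mul, ← zpow_natCast (g ^ i), ← zpow_mul, mul_comm, zpow_mul, zpow_natCast, hgp,
        one_zpow]
end Summit.BirchSwinnertonDyer.BirchSwinnertonDyer.Theorems.DefmuSupersingularTheta

end
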